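import Literature.MathematicalPhysics.QuantumFieldTheory.ONVectorSumRule
import Literature.MathematicalPhysics.QuantumFieldTheory.ConformalBootstrap3D.SingleCorrelatorCertificate
import HarnessLib

/-!
# Certificate format for the `O(N)` vector bootstrap (`⟨φᵢφⱼφₖφₗ⟩`, point functionals): the typed
# datum, the finite list of obligations, and the dictionary to the single-correlator primitives

Topic `MathematicalPhysics/QuantumFieldTheory`; definitions + theorems only (no named fact, no
instance, no `sorry`).

`ONVectorSumRule.lean` types Kos–Poland–Simmons-Duffin, JHEP 06 (2014) 091, §2.1–§2.2 over OPAQUE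
channel functions of the cross-ratios `(u, v)` and proves the exclusion step
`ONVectorSumRule.false_of_pointFunctional` ("(N) + (P) + crossing ⇒ contradiction") with every
analytic hypothesis explicit.  This file is the bookkeeping layer between that theorem and a
certificate CHECKER, in the shape of `ConformalBootstrap3D/SingleCorrelatorCertificate.lean`
(the `ℤ₂` single correlator `⟨σσσσ⟩`):

* §1 `PullbackOnDiamond`, `IsChannelBlockUV Δ ℓ G` — what an admissible channel function IS: on
  the Euclidean diamond `u = z z̄`, `v = (1-z)(1-z̄)`, `0 < z, z̄ < 1`, `G` is the pull-back of a
  genuine 3D block `g` (`ConformalBootstrap3D.IsConformalBlock3D 0 0 Δ ℓ g`, equal external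
  dimensions); no root map `(u,v) ↦ (z,z̄)` is needed, only the forward substitution.
* §2 `VectorDatum N` — the `O(N)` analogue, for what the single correlator of the vector `φᵢ`
  sees, of `ConformalBootstrap3D.SigmaEpsilonData`: three channel expansions `S⁺` (even spins,
  unit operator isolated with `λ²_𝟙 g_𝟙 = 1`), `T⁺` (even spins), `A⁻` (odd spins) with
  `λ² ≥ 0`, unitary dimensions, typed blocks, convergence on the diamond, and crossing symmetry
  (§2.1 of the source); `VectorGaps` = the spectral assumption of a run (§2.2 step 1; §4.1:
  "all singlet scalar operators have dimension greater than `Δ_S`, all symmetric tensor scalars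
  have dimension greater than `1`, and … all the other operators … only … the unitarity
  conditions"; §4.2 symmetrically); `VectorExcluded N A Q` — no datum with `Δ_φ ∈ Q` satisfies
  the gaps `A` (the CLAIM a certificate establishes; closed under union of `Q`, monotone).
* §3 `RowNonnegS/T/A`, `VectorObligations α N A Q E` — the positivity conditions of §2.2 step 2,
  `α(V_unit) > 0`, `α(V_{R,Δ,ℓ}) ≥ 0` for every `(R, Δ, ℓ)` allowed by `A`, split à la
  Rattazzi–Rychkov–Tonni–Vichi 2008 §5.5 into a trial range `Δ < E` (scalars above the gap;
  spins `ℓ ≥ 1` above the unitarity bound `ℓ + 1`, automatically `ℓ < E - 1`) and TAILS `Δ ≥ E`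
  per sector (the analytic lemma, a hypothesis here); `VectorObligations.nonnegS/T/A` and
  `VectorObligations.excluded` — a discharged list for a point functional with nodes on the
  diamond IS a proof of `VectorExcluded N A Q` (through `false_of_pointFunctional`; PROVED).
* §4 `scalarRows_of_table`, `spinRows_of_table`, `VectorObligations.of_tables` — the trial range
  from FINITE tables of `Δ`-cells per sector and spin (cells, not grid points; PROVED).
* §5 the DICTIONARY to `ConformalBootstrap3D`: at diamond nodes `F⁻[G](u,v) = crossF s (-1) g`,
  `F⁺[G](u,v) = crossF s 1 g` (`PullbackOnDiamond.fm_eq/fp_eq`), hence each `O(N)` row of the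
  three-component point functional `α = Σ_k Σ_r w_{k,r} ev_{(u_k,v_k),r}` is the sum of ONE
  `F⁻`-type and ONE `F⁺`-type single-correlator point functional with explicit weights
  (`pointFunctional_VS_eq/VT_eq/VA_eq`; `rowNonnegS/T/A_of_crossF`, `unit_eq`) — so a checker
  built for `⟨σσσσ⟩` point certificates evaluates `O(N)` rows with the same block enclosures.

What this file does NOT contain: any block value or enclosure, any concrete functional, table,
`Q`, `E` or gap; the tail lemmas; uniqueness of typed blocks (T1 of `SigmaEpsilonSystem.lean` is
not presupposed: rows quantify over EVERY typed `g`); derivative functionals; mixed correlators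
(`ONMixedSumRule.lean`); any statement about a lattice model.  Every published number belongs to a
client cell's ledger; this is format, not a bound.

Sources: F. Kos, D. Poland, D. Simmons-Duffin, *Bootstrapping the O(N) vector models*, JHEP 06
(2014) 091, arXiv:1307.6856, §2.1 (sectors `S⁺, T⁺, A⁻`, sum rule), §2.2 (steps 1–3), §4.1–§4.2
(the gap assumptions); R. Rattazzi, V. S. Rychkov, E. Tonni, A. Vichi, JHEP 12 (2008) 031, §5.5
(trial set + asymptotics); M. Hogervorst, S. Rychkov, JHEP 11 (2013) 140, §4.3 (crossing imposed
point by point); D. Poland, S. Rychkov, A. Vichi, Rev. Mod. Phys. 91 (2019) 015002, §II.C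
eq. (19) (unitarity bounds).  Tree: `ONVectorSumRule` (`VS/VT/VA`, `Fm/Fp`, `CrossingAt`,
`pointFunctional`, `false_of_pointFunctional`), `ConformalBootstrap3D` (`IsConformalBlock3D`,
`unitarityBound3D`, `crossF`, `pointFunctional`, `exists_step_of_mem_Icc`).
-/

namespace Literature.MathematicalPhysics.QuantumFieldTheory.ONVectorCertificate

open Set Finset
open ONVectorSumRule (Fm Fp VS VT VA CrossingAt)
open ConformalBootstrap3D (IsConformalBlock3D unitarityBound3D crossF exists_step_of_mem_Icc)

noncomputable section

/-! ### §1 Admissible channel functions: pull-backs of typed blocks to the Euclidean diamond -/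

/-- `G(u,v)` restricted to the Euclidean diamond is the pull-back of `g(z,z̄)` under
`u = z z̄`, `v = (1-z)(1-z̄)`, `0 < z, z̄ < 1` (the change of variables of the cited §2.2 /
Hogervorst–Rychkov §4.3; only the forward substitution is used).
[cite: KosPolandSimmonsduffin2014ON, §2.2] -/
def PullbackOnDiamond (G g : ℝ → ℝ → ℝ) : Prop :=
  ∀ z zb : ℝ, z ∈ Ioo (0 : ℝ) 1 → zb ∈ Ioo (0 : ℝ) 1 → G (z * zb) ((1 - z) * (1 - zb)) = g z zb

/-- **Admissible channel function** of dimension `Δ` and spin `ℓ` in cross-ratio variables: the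
pull-back to the diamond of a genuine 3D block with equal external dimensions,
`ConformalBootstrap3D.IsConformalBlock3D 0 0 Δ ℓ g` (the typed block predicate of the `σ–ε`
files; at the unitarity bound by continuity from above).  Off the diamond `G` is unconstrained —
the sum rule is only ever evaluated on it. [cite: KosPolandSimmonsduffin2014ON, §2.1] -/
def IsChannelBlockUV (Δ : ℝ) (ℓ : ℕ) (G : ℝ → ℝ → ℝ) : Prop :=
  ∃ g : ℝ → ℝ → ℝ, IsConformalBlock3D 0 0 Δ ℓ g ∧ PullbackOnDiamond G g

namespace PullbackOnDiamond

variable {G g : ℝ → ℝ → ℝ} {z zb : ℝ}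

/-- The node value. [cite: KosPolandSimmonsduffin2014ON, §2.2] -/
theorem eval (h : PullbackOnDiamond G g) (hz : z ∈ Ioo (0 : ℝ) 1) (hzb : zb ∈ Ioo (0 : ℝ) 1) :
    G (z * zb) ((1 - z) * (1 - zb)) = g z zb :=
  h z zb hz hzb

/-- The crossed node value: `G(v,u) = g(1-z, 1-z̄)` (the relation at the diamond point
`(1-z, 1-z̄)`). [cite: KosPolandSimmonsduffin2014ON, §2.2] -/
theorem eval_swap (h : PullbackOnDiamond G g) (hz : z ∈ Ioo (0 : ℝ) 1) (hzb : zb ∈ Ioo (0 : ℝ) 1) :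
    G ((1 - z) * (1 - zb)) (z * zb) = g (1 - z) (1 - zb) := by
  simpa only [sub_sub_cancel] using
    h (1 - z) (1 - zb) ⟨by linarith [hz.2], by linarith [hz.1]⟩ ⟨by linarith [hzb.2], by linarith [hzb.1]⟩

/-- **Dictionary, `F⁻`.** At a diamond node, `F⁻[G](u,v) = v^s G(u,v) - u^s G(v,u)` is the
`σ–ε` files' `crossF s (-1) g (z, z̄)`. [cite: KosPolandSimmonsduffin2014ON, §2.1] -/
theorem fm_eq (h : PullbackOnDiamond G g) (hz : z ∈ Ioo (0 : ℝ) 1) (hzb : zb ∈ Ioo (0 : ℝ) 1)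
    (s : ℝ) : Fm s G (z * zb) ((1 - z) * (1 - zb)) = crossF s (-1) g z zb := by
  rw [Fm, crossF, h.eval hz hzb, h.eval_swap hz hzb]
  ring

/-- **Dictionary, `F⁺`.** At a diamond node, `F⁺[G](u,v) = crossF s 1 g (z, z̄)`.
[cite: KosPolandSimmonsduffin2014ON, §2.1] -/
theorem fp_eq (h : PullbackOnDiamond G g) (hz : z ∈ Ioo (0 : ℝ) 1) (hzb : zb ∈ Ioo (0 : ℝ) 1)
    (s : ℝ) : Fp s G (z * zb) ((1 - z) * (1 - zb)) = crossF s 1 g z zb := by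
  rw [Fp, crossF, h.eval hz hzb, h.eval_swap hz hzb]
  ring

/-- The unit channel function pulls back to the unit block. [cite: KosPolandSimmonsduffin2014ON, §2.2] -/
theorem one : PullbackOnDiamond (fun _ _ => (1 : ℝ)) (fun _ _ => (1 : ℝ)) := fun _ _ _ _ => rfl

end PullbackOnDiamond

/-! ### §2 The typed datum, the gap assumptions, and the claim `VectorExcluded` -/

/-- **`O(N)` vector CFT datum** as seen by `⟨φᵢφⱼφₖφₗ⟩` (the cited §2.1): external dimension
`Δ_φ`; for each sector `R ∈ {S⁺, T⁺, A⁻}` an index type of exchanged primaries OTHER than the unit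
(which sits in `S⁺` with `λ² g = 1` and is isolated, §2.2 eq. "`0 = V_unit + Σ λ² V`"), their
dimensions, spins (even, even, odd), squared OPE coefficients `λ² ≥ 0`, unitary dimensions
(`unitarityBound3D`), channel functions that ARE typed blocks on the diamond (`IsChannelBlockUV`),
channel sums `G_S ∋ 1, G_T, G_A` to which the expansions converge at every diamond point, and
crossing symmetry `CrossingAt N Δ_φ G_S G_T G_A` at every diamond point.  Nothing about which
operators exist beyond this correlator. [cite: KosPolandSimmonsduffin2014ON, §2.1] -/
structure VectorDatum (N : ℕ) where
  /-- external dimension `Δ_φ` -/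
  Δφ : ℝ
  /-- index types of the exchanged non-unit primaries, per sector -/
  ιS : Type
  ιT : Type
  ιA : Type
  dimS : ιS → ℝ
  spinS : ιS → ℕ
  coefS : ιS → ℝ
  chanS : ιS → ℝ → ℝ → ℝ
  dimT : ιT → ℝ
  spinT : ιT → ℕ
  coefT : ιT → ℝ
  chanT : ιT → ℝ → ℝ → ℝ
  dimA : ιA → ℝ
  spinA : ιA → ℕ
  coefA : ιA → ℝ
  chanA : ιA → ℝ → ℝ → ℝ
  /-- channel sums (`G_S` INCLUDING the unit contribution `1`) -/
  GS : ℝ → ℝ → ℝ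
  GT : ℝ → ℝ → ℝ
  GA : ℝ → ℝ → ℝ
  coefS_nonneg : ∀ o, 0 ≤ coefS o
  coefT_nonneg : ∀ o, 0 ≤ coefT o
  coefA_nonneg : ∀ o, 0 ≤ coefA o
  spinS_even : ∀ o, Even (spinS o)
  spinT_even : ∀ o, Even (spinT o)
  spinA_odd : ∀ o, Odd (spinA o)
  unitaryS : ∀ o, unitarityBound3D (spinS o) ≤ dimS o
  unitaryT : ∀ o, unitarityBound3D (spinT o) ≤ dimT o
  unitaryA : ∀ o, unitarityBound3D (spinA o) ≤ dimA o
  blockS : ∀ o, IsChannelBlockUV (dimS o) (spinS o) (chanS o)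
  blockT : ∀ o, IsChannelBlockUV (dimT o) (spinT o) (chanT o)
  blockA : ∀ o, IsChannelBlockUV (dimA o) (spinA o) (chanA o)
  sumS : ∀ z zb : ℝ, z ∈ Ioo (0 : ℝ) 1 → zb ∈ Ioo (0 : ℝ) 1 →
    HasSum (fun o => coefS o * chanS o (z * zb) ((1 - z) * (1 - zb)))
      (GS (z * zb) ((1 - z) * (1 - zb)) - 1)
  sumT : ∀ z zb : ℝ, z ∈ Ioo (0 : ℝ) 1 → zb ∈ Ioo (0 : ℝ) 1 →
    HasSum (fun o => coefT o * chanT o (z * zb) ((1 - z) * (1 - zb)))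
      (GT (z * zb) ((1 - z) * (1 - zb)))
  sumA : ∀ z zb : ℝ, z ∈ Ioo (0 : ℝ) 1 → zb ∈ Ioo (0 : ℝ) 1 →
    HasSum (fun o => coefA o * chanA o (z * zb) ((1 - z) * (1 - zb)))
      (GA (z * zb) ((1 - z) * (1 - zb)))
  crossing : ∀ z zb : ℝ, z ∈ Ioo (0 : ℝ) 1 → zb ∈ Ioo (0 : ℝ) 1 →
    CrossingAt N Δφ GS GT GA (z * zb) ((1 - z) * (1 - zb))

/-- **The spectral assumption of a run** (§2.2 step 1, in the form of §4.1/§4.2): every singlet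
scalar has `Δ ≥ Δ_S^*` and every symmetric-tensor scalar has `Δ ≥ Δ_T^*`; everything else only
unitarity.  (`§4.1`: `Δ_T^* = 1`; `§4.2`: `Δ_S^* = 1`.) [cite: KosPolandSimmonsduffin2014ON, §4.1] -/
structure VectorGaps where
  /-- gap below the first singlet scalar -/
  ΔS : ℝ
  /-- gap below the first symmetric-tensor scalar -/
  ΔT : ℝ

/-- The datum obeys the gaps. [cite: KosPolandSimmonsduffin2014ON, §4.1] -/
def VectorDatum.SatisfiesGaps {N : ℕ} (D : VectorDatum N) (A : VectorGaps) : Prop :=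
  (∀ o, D.spinS o = 0 → A.ΔS ≤ D.dimS o) ∧ ∀ o, D.spinT o = 0 → A.ΔT ≤ D.dimT o

/-- **The claim of a certificate**: no `O(N)` vector datum with `Δ_φ ∈ Q` obeys the gaps `A`
(§2.2 step 3: "the assumption (1) is ruled out"). [cite: KosPolandSimmonsduffin2014ON, §2.2] -/
def VectorExcluded (N : ℕ) (A : VectorGaps) (Q : Set ℝ) : Prop :=
  ∀ D : VectorDatum N, D.Δφ ∈ Q → D.SatisfiesGaps A → False

/-- Monotone in `Q`. [cite: KosPolandSimmonsduffin2014ON, §2.2] -/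
theorem VectorExcluded.mono {N : ℕ} {A : VectorGaps} {Q Q' : Set ℝ} (hQ : Q' ⊆ Q)
    (h : VectorExcluded N A Q) : VectorExcluded N A Q' :=
  fun D hD hA => h D (hQ hD) hA

/-- A scan is a union of certified pieces. [cite: KosPolandSimmonsduffin2014ON, §2.2] -/
theorem VectorExcluded.union {N : ℕ} {A : VectorGaps} {Q Q' : Set ℝ} (h : VectorExcluded N A Q)
    (h' : VectorExcluded N A Q') : VectorExcluded N A (Q ∪ Q') :=
  fun D hD hA => hD.elim (fun h1 => h D h1 hA) fun h2 => h' D h2 hA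

/-- Larger gaps are excluded with smaller ones. [cite: KosPolandSimmonsduffin2014ON, §4.1] -/
theorem VectorExcluded.of_le {N : ℕ} {A A' : VectorGaps} {Q : Set ℝ} (hS : A.ΔS ≤ A'.ΔS)
    (hT : A.ΔT ≤ A'.ΔT) (h : VectorExcluded N A Q) : VectorExcluded N A' Q :=
  fun D hD hA' => h D hD ⟨fun o ho => hS.trans (hA'.1 o ho), fun o ho => hT.trans (hA'.2 o ho)⟩

/-! ### §3 Rows and the obligation list -/

/-- Row non-negativity, singlet sector: `α(V_S[G]) ≥ 0` at external dimension `s` for every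
admissible channel function of type `(Δ, ℓ)`. [cite: KosPolandSimmonsduffin2014ON, §2.2] -/
def RowNonnegS (α : (ℝ → ℝ → Fin 3 → ℝ) →ₗ[ℝ] ℝ) (s Δ : ℝ) (ℓ : ℕ) : Prop :=
  ∀ G : ℝ → ℝ → ℝ, IsChannelBlockUV Δ ℓ G → 0 ≤ α (fun u v => VS s G u v)

/-- Row non-negativity, symmetric-tensor sector: `α(V_T[G]) ≥ 0`.
[cite: KosPolandSimmonsduffin2014ON, §2.2] -/
def RowNonnegT (α : (ℝ → ℝ → Fin 3 → ℝ) →ₗ[ℝ] ℝ) (N : ℕ) (s Δ : ℝ) (ℓ : ℕ) : Prop :=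
  ∀ G : ℝ → ℝ → ℝ, IsChannelBlockUV Δ ℓ G → 0 ≤ α (fun u v => VT N s G u v)

/-- Row non-negativity, antisymmetric sector: `α(V_A[G]) ≥ 0`.
[cite: KosPolandSimmonsduffin2014ON, §2.2] -/
def RowNonnegA (α : (ℝ → ℝ → Fin 3 → ℝ) →ₗ[ℝ] ℝ) (s Δ : ℝ) (ℓ : ℕ) : Prop :=
  ∀ G : ℝ → ℝ → ℝ, IsChannelBlockUV Δ ℓ G → 0 ≤ α (fun u v => VA s G u v)

/-- **The obligations of an `O(N)` vector certificate** for a functional `α`, gaps `A`, a set `Q`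
of external dimensions and a tail threshold `E` (§2.2 step 2 truncated as in Rattazzi–Rychkov–
Tonni–Vichi 2008 §5.5): (O1) `unit_pos`; trial range `Δ < E`: (O2) singlet scalars `Δ ≥ Δ_S^*`,
(O3) tensor scalars `Δ ≥ Δ_T^*`, (O4)/(O5) singlet/tensor even spins `ℓ ≥ 2` with `Δ ≥ ℓ + 1`,
(O6) antisymmetric odd spins with `Δ ≥ ℓ + 1`; tails `Δ ≥ E` above the unitarity bound:
(O7) `tailS` (even `ℓ`), (O8) `tailT` (even `ℓ`), (O9) `tailA` (odd `ℓ`) — hypotheses to be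
discharged by an analytic lemma, never by sampling. [cite: RattazziEtAl2008, §5.5] -/
structure VectorObligations (α : (ℝ → ℝ → Fin 3 → ℝ) →ₗ[ℝ] ℝ) (N : ℕ) (A : VectorGaps)
    (Q : Set ℝ) (E : ℝ) : Prop where
  /-- (O1) `α(V_S[1]) > 0` on `Q`. -/
  unit_pos : ∀ s ∈ Q, 0 < α (fun u v => VS s (fun _ _ => (1 : ℝ)) u v)
  /-- (O2) singlet scalars in the trial range. -/
  scalarS : ∀ s ∈ Q, ∀ Δ : ℝ, A.ΔS ≤ Δ → Δ < E → RowNonnegS α s Δ 0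
  /-- (O3) symmetric-tensor scalars in the trial range. -/
  scalarT : ∀ s ∈ Q, ∀ Δ : ℝ, A.ΔT ≤ Δ → Δ < E → RowNonnegT α N s Δ 0
  /-- (O4) singlet even spins `ℓ ≠ 0` in the trial range. -/
  spinS : ∀ s ∈ Q, ∀ ℓ : ℕ, Even ℓ → ℓ ≠ 0 → ∀ Δ : ℝ, (ℓ : ℝ) + 1 ≤ Δ → Δ < E →
    RowNonnegS α s Δ ℓ
  /-- (O5) symmetric-tensor even spins `ℓ ≠ 0` in the trial range. -/
  spinT : ∀ s ∈ Q, ∀ ℓ : ℕ, Even ℓ → ℓ ≠ 0 → ∀ Δ : ℝ, (ℓ : ℝ) + 1 ≤ Δ → Δ < E →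
    RowNonnegT α N s Δ ℓ
  /-- (O6) antisymmetric odd spins in the trial range. -/
  spinA : ∀ s ∈ Q, ∀ ℓ : ℕ, Odd ℓ → ∀ Δ : ℝ, (ℓ : ℝ) + 1 ≤ Δ → Δ < E → RowNonnegA α s Δ ℓ
  /-- (O7) singlet tail. -/
  tailS : ∀ s ∈ Q, ∀ ℓ : ℕ, Even ℓ → ∀ Δ : ℝ, unitarityBound3D ℓ ≤ Δ → E ≤ Δ → RowNonnegS α s Δ ℓ
  /-- (O8) symmetric-tensor tail. -/
  tailT : ∀ s ∈ Q, ∀ ℓ : ℕ, Even ℓ → ∀ Δ : ℝ, unitarityBound3D ℓ ≤ Δ → E ≤ Δ →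
    RowNonnegT α N s Δ ℓ
  /-- (O9) antisymmetric tail. -/
  tailA : ∀ s ∈ Q, ∀ ℓ : ℕ, Odd ℓ → ∀ Δ : ℝ, unitarityBound3D ℓ ≤ Δ → E ≤ Δ → RowNonnegA α s Δ ℓ

namespace VectorObligations

variable {α : (ℝ → ℝ → Fin 3 → ℝ) →ₗ[ℝ] ℝ} {N : ℕ} {A : VectorGaps} {Q : Set ℝ} {E : ℝ}

/-- (O2), (O4), (O7) cover every singlet row allowed by the gaps (case split `Δ < E`, `ℓ = 0`;
for `ℓ ≠ 0` the unitarity bound reads `ℓ + 1 ≤ Δ`). [cite: RattazziEtAl2008, §5.5] -/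
theorem nonnegS (h : VectorObligations α N A Q E) :
    ∀ s ∈ Q, ∀ (Δ : ℝ) (ℓ : ℕ), Even ℓ → unitarityBound3D ℓ ≤ Δ → (ℓ = 0 → A.ΔS ≤ Δ) →
      RowNonnegS α s Δ ℓ := by
  intro s hs Δ ℓ hℓ hb hgap
  rcases lt_or_ge Δ E with hlt | hge
  · by_cases h0 : ℓ = 0
    · subst h0
      exact h.scalarS s hs Δ (hgap rfl) hlt
    · have hb' : (ℓ : ℝ) + 1 ≤ Δ := by simpa [unitarityBound3D, h0] using hb
      exact h.spinS s hs ℓ hℓ h0 Δ hb' hlt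
  · exact h.tailS s hs ℓ hℓ Δ hb hge

/-- (O3), (O5), (O8) cover every symmetric-tensor row allowed by the gaps.
[cite: RattazziEtAl2008, §5.5] -/
theorem nonnegT (h : VectorObligations α N A Q E) :
    ∀ s ∈ Q, ∀ (Δ : ℝ) (ℓ : ℕ), Even ℓ → unitarityBound3D ℓ ≤ Δ → (ℓ = 0 → A.ΔT ≤ Δ) →
      RowNonnegT α N s Δ ℓ := by
  intro s hs Δ ℓ hℓ hb hgap
  rcases lt_or_ge Δ E with hlt | hge
  · by_cases h0 : ℓ = 0
    · subst h0
      exact h.scalarT s hs Δ (hgap rfl) hlt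
    · have hb' : (ℓ : ℝ) + 1 ≤ Δ := by simpa [unitarityBound3D, h0] using hb
      exact h.spinT s hs ℓ hℓ h0 Δ hb' hlt
  · exact h.tailT s hs ℓ hℓ Δ hb hge

/-- (O6), (O9) cover every antisymmetric row (odd `ℓ`, so `ℓ ≠ 0` and the bound is `ℓ + 1`).
[cite: RattazziEtAl2008, §5.5] -/
theorem nonnegA (h : VectorObligations α N A Q E) :
    ∀ s ∈ Q, ∀ (Δ : ℝ) (ℓ : ℕ), Odd ℓ → unitarityBound3D ℓ ≤ Δ → RowNonnegA α s Δ ℓ := by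
  intro s hs Δ ℓ hℓ hb
  rcases lt_or_ge Δ E with hlt | hge
  · have h0 : ℓ ≠ 0 := by obtain ⟨m, rfl⟩ := hℓ; omega
    have hb' : (ℓ : ℝ) + 1 ≤ Δ := by simpa [unitarityBound3D, h0] using hb
    exact h.spinA s hs ℓ hℓ Δ hb' hlt
  · exact h.tailA s hs ℓ hℓ Δ hb hge

/-- **A discharged obligation list is a certificate.** For the three-component point functional
`α = Σ_k Σ_r w_{k,r} ev_{(u_k, v_k), r}` with nodes ON THE DIAMOND, `u_k = z_k z̄_k`,
`v_k = (1-z_k)(1-z̄_k)`, `0 < z_k, z̄_k < 1`, the obligations on `Q` prove `VectorExcluded N A Q`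
(`2 ≤ N`): every hypothesis of `ONVectorSumRule.false_of_pointFunctional` is supplied by the
datum (convergence and crossing at the nodes and at the crossed nodes `(v_k, u_k)`, which are the
diamond points `(1-z_k, 1-z̄_k)`) or by `nonnegS/T/A`. [cite: KosPolandSimmonsduffin2014ON, §2.2] -/
theorem excluded (hN : 2 ≤ N) {M : ℕ} {w : Fin M → Fin 3 → ℝ} {z zb : Fin M → ℝ}
    (hz : ∀ k, z k ∈ Ioo (0 : ℝ) 1) (hzb : ∀ k, zb k ∈ Ioo (0 : ℝ) 1)
    (h : VectorObligations (ONVectorSumRule.pointFunctional w (fun k => z k * zb k)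
      (fun k => (1 - z k) * (1 - zb k))) N A Q E) : VectorExcluded N A Q := by
  intro D hQ hA
  have hz' : ∀ k, 1 - z k ∈ Ioo (0 : ℝ) 1 := fun k =>
    ⟨by linarith [(hz k).2], by linarith [(hz k).1]⟩
  have hzb' : ∀ k, 1 - zb k ∈ Ioo (0 : ℝ) 1 := fun k =>
    ⟨by linarith [(hzb k).2], by linarith [(hzb k).1]⟩
  refine ONVectorSumRule.false_of_pointFunctional hN w (fun k => z k * zb k)
    (fun k => (1 - z k) * (1 - zb k)) D.Δφ D.coefS_nonneg D.coefT_nonneg D.coefA_nonneg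
    (fun k => D.sumS (z k) (zb k) (hz k) (hzb k)) (fun k => ?_)
    (fun k => D.sumT (z k) (zb k) (hz k) (hzb k)) (fun k => ?_)
    (fun k => D.sumA (z k) (zb k) (hz k) (hzb k)) (fun k => ?_)
    (fun k => D.crossing (z k) (zb k) (hz k) (hzb k))
    (fun o => h.nonnegS D.Δφ hQ (D.dimS o) (D.spinS o) (D.spinS_even o) (D.unitaryS o)
      (hA.1 o) (D.chanS o) (D.blockS o))
    (fun o => h.nonnegT D.Δφ hQ (D.dimT o) (D.spinT o) (D.spinT_even o) (D.unitaryT o)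
      (hA.2 o) (D.chanT o) (D.blockT o))
    (fun o => h.nonnegA D.Δφ hQ (D.dimA o) (D.spinA o) (D.spinA_odd o) (D.unitaryA o)
      (D.chanA o) (D.blockA o))
    (h.unit_pos D.Δφ hQ)
  · simpa only [sub_sub_cancel] using D.sumS (1 - z k) (1 - zb k) (hz' k) (hzb' k)
  · simpa only [sub_sub_cancel] using D.sumT (1 - z k) (1 - zb k) (hz' k) (hzb' k)
  · simpa only [sub_sub_cancel] using D.sumA (1 - z k) (1 - zb k) (hz' k) (hzb' k)

end VectorObligations

/-! ### §4 The trial range from finite cell tables -/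

/-- A scalar row family on `[gap, E)` from a table of cells `t₀ ≤ gap`, `t_K ≥ E` (`K ≥ 1`), each
cell verified uniformly in `Δ ∈ [t_k, t_{k+1}]` and `s ∈ Q` (cells, not grid points).
[cite: RattazziEtAl2008, §5.5] -/
theorem scalarRows_of_table {P : ℝ → ℝ → Prop} {Q : Set ℝ} {gap E : ℝ} (t : ℕ → ℝ) {K : ℕ}
    (hK : 1 ≤ K) (h0 : t 0 ≤ gap) (hK' : E ≤ t K)
    (hcell : ∀ k < K, ∀ s ∈ Q, ∀ Δ ∈ Icc (t k) (t (k + 1)), P s Δ) :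
    ∀ s ∈ Q, ∀ Δ : ℝ, gap ≤ Δ → Δ < E → P s Δ := by
  intro s hs Δ hg hlt
  obtain ⟨k, hk, hk1, hk2⟩ := exists_step_of_mem_Icc t hK (h0.trans hg) (hlt.le.trans hK')
  exact hcell k hk s hs Δ ⟨hk1, hk2⟩

/-- A spinning row family (`ℓ ≠ 0` of parity `par`, `ℓ + 1 ≤ Δ < E`) from one cell row per spin
`ℓ < L`, where `E ≤ L + 1` bounds the spins. [cite: RattazziEtAl2008, §5.5] -/
theorem spinRows_of_table {P : ℝ → ℝ → ℕ → Prop} {par : ℕ → Prop} {Q : Set ℝ} {E : ℝ} (L : ℕ)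
    (hL : E ≤ (L : ℝ) + 1) (t : ℕ → ℕ → ℝ) (K : ℕ → ℕ) (hK : ∀ ℓ < L, 1 ≤ K ℓ)
    (h0 : ∀ ℓ < L, t ℓ 0 ≤ (ℓ : ℝ) + 1) (hK' : ∀ ℓ < L, E ≤ t ℓ (K ℓ))
    (hcell : ∀ ℓ < L, par ℓ → ℓ ≠ 0 → ∀ k < K ℓ, ∀ s ∈ Q, ∀ Δ ∈ Icc (t ℓ k) (t ℓ (k + 1)),
      P s Δ ℓ) :
    ∀ s ∈ Q, ∀ ℓ : ℕ, par ℓ → ℓ ≠ 0 → ∀ Δ : ℝ, (ℓ : ℝ) + 1 ≤ Δ → Δ < E → P s Δ ℓ := by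
  intro s hs ℓ hℓ h0ℓ Δ hb hlt
  have hℓL : ℓ < L := by
    have h' : (ℓ : ℝ) < (L : ℝ) := by linarith [hlt.trans_le hL]
    exact_mod_cast h'
  obtain ⟨k, hk, hk1, hk2⟩ :=
    exists_step_of_mem_Icc (t ℓ) (hK ℓ hℓL) ((h0 ℓ hℓL).trans hb) (hlt.le.trans (hK' ℓ hℓL))
  exact hcell ℓ hℓL hℓ h0ℓ k hk s hs Δ ⟨hk1, hk2⟩

/-- **Assembly of the obligations from finite tables** (the shape of a certificate file): (O1),
the three tails with threshold `E ≤ L + 1`, a scalar cell row per scalar sector (`S`, `T`) and a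
cell row per spin `0 < ℓ < L` of the right parity per sector (`S`, `T` even; `A` odd).
[cite: RattazziEtAl2008, §5.5] -/
theorem VectorObligations.of_tables {α : (ℝ → ℝ → Fin 3 → ℝ) →ₗ[ℝ] ℝ} {N : ℕ} {A : VectorGaps}
    {Q : Set ℝ} {E : ℝ} (L : ℕ) (hL : E ≤ (L : ℝ) + 1)
    (hU : ∀ s ∈ Q, 0 < α (fun u v => VS s (fun _ _ => (1 : ℝ)) u v))
    (htS : ∀ s ∈ Q, ∀ ℓ : ℕ, Even ℓ → ∀ Δ : ℝ, unitarityBound3D ℓ ≤ Δ → E ≤ Δ →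
      RowNonnegS α s Δ ℓ)
    (htT : ∀ s ∈ Q, ∀ ℓ : ℕ, Even ℓ → ∀ Δ : ℝ, unitarityBound3D ℓ ≤ Δ → E ≤ Δ →
      RowNonnegT α N s Δ ℓ)
    (htA : ∀ s ∈ Q, ∀ ℓ : ℕ, Odd ℓ → ∀ Δ : ℝ, unitarityBound3D ℓ ≤ Δ → E ≤ Δ →
      RowNonnegA α s Δ ℓ)
    (tS : ℕ → ℝ) {KS : ℕ} (hKS : 1 ≤ KS) (htS0 : tS 0 ≤ A.ΔS) (htSK : E ≤ tS KS)
    (hcS : ∀ k < KS, ∀ s ∈ Q, ∀ Δ ∈ Icc (tS k) (tS (k + 1)), RowNonnegS α s Δ 0)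
    (tT : ℕ → ℝ) {KT : ℕ} (hKT : 1 ≤ KT) (htT0 : tT 0 ≤ A.ΔT) (htTK : E ≤ tT KT)
    (hcT : ∀ k < KT, ∀ s ∈ Q, ∀ Δ ∈ Icc (tT k) (tT (k + 1)), RowNonnegT α N s Δ 0)
    (t : Fin 3 → ℕ → ℕ → ℝ) (K : Fin 3 → ℕ → ℕ) (hK : ∀ r, ∀ ℓ < L, 1 ≤ K r ℓ)
    (ht0 : ∀ r, ∀ ℓ < L, t r ℓ 0 ≤ (ℓ : ℝ) + 1) (htK : ∀ r, ∀ ℓ < L, E ≤ t r ℓ (K r ℓ))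
    (hc0 : ∀ ℓ < L, Even ℓ → ℓ ≠ 0 → ∀ k < K 0 ℓ, ∀ s ∈ Q, ∀ Δ ∈ Icc (t 0 ℓ k) (t 0 ℓ (k + 1)),
      RowNonnegS α s Δ ℓ)
    (hc1 : ∀ ℓ < L, Even ℓ → ℓ ≠ 0 → ∀ k < K 1 ℓ, ∀ s ∈ Q, ∀ Δ ∈ Icc (t 1 ℓ k) (t 1 ℓ (k + 1)),
      RowNonnegT α N s Δ ℓ)
    (hc2 : ∀ ℓ < L, Odd ℓ → ℓ ≠ 0 → ∀ k < K 2 ℓ, ∀ s ∈ Q, ∀ Δ ∈ Icc (t 2 ℓ k) (t 2 ℓ (k + 1)),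
      RowNonnegA α s Δ ℓ) :
    VectorObligations α N A Q E where
  unit_pos := hU
  scalarS := scalarRows_of_table (P := fun s Δ => RowNonnegS α s Δ 0) tS hKS htS0 htSK hcS
  scalarT := scalarRows_of_table (P := fun s Δ => RowNonnegT α N s Δ 0) tT hKT htT0 htTK hcT
  spinS := spinRows_of_table (P := fun s Δ ℓ => RowNonnegS α s Δ ℓ) L hL (t 0) (K 0) (hK 0)
    (ht0 0) (htK 0) hc0
  spinT := spinRows_of_table (P := fun s Δ ℓ => RowNonnegT α N s Δ ℓ) L hL (t 1) (K 1) (hK 1)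
    (ht0 1) (htK 1) hc1
  spinA := fun s hs ℓ hℓ Δ hb hlt =>
    spinRows_of_table (P := fun s Δ ℓ => RowNonnegA α s Δ ℓ) L hL (t 2) (K 2) (hK 2) (ht0 2)
      (htK 2) hc2 s hs ℓ hℓ (by obtain ⟨m, rfl⟩ := hℓ; omega) Δ hb hlt
  tailS := htS
  tailT := htT
  tailA := htA

/-! ### §5 Dictionary: each `O(N)` row is one `F⁻`-type plus one `F⁺`-type single-correlator
point functional -/

section Dictionary

variable {M : ℕ}

/-- The three-component point functional with nodes on the diamond, `u_k = z_k z̄_k`,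
`v_k = (1-z_k)(1-z̄_k)`. [cite: HogervorstRychkov2013, §4.3] -/
def diamondFunctional (w : Fin M → Fin 3 → ℝ) (z zb : Fin M → ℝ) :
    (ℝ → ℝ → Fin 3 → ℝ) →ₗ[ℝ] ℝ :=
  ONVectorSumRule.pointFunctional w (fun k => z k * zb k) (fun k => (1 - z k) * (1 - zb k))

/-- `F⁻`-weights of the singlet row: `w_{k,1}`. [cite: KosPolandSimmonsduffin2014ON, §2.1] -/
def wSm (w : Fin M → Fin 3 → ℝ) : Fin M → ℝ := fun k => w k 1
/-- `F⁺`-weights of the singlet row: `w_{k,2}`. [cite: KosPolandSimmonsduffin2014ON, §2.1] -/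
def wSp (w : Fin M → Fin 3 → ℝ) : Fin M → ℝ := fun k => w k 2
/-- `F⁻`-weights of the symmetric-tensor row: `w_{k,0} + (1 - 2/N) w_{k,1}`.
[cite: KosPolandSimmonsduffin2014ON, §2.1] -/
def wTm (N : ℕ) (w : Fin M → Fin 3 → ℝ) : Fin M → ℝ :=
  fun k => w k 0 + (1 - 2 / (N : ℝ)) * w k 1
/-- `F⁺`-weights of the symmetric-tensor row: `-(1 + 2/N) w_{k,2}`.
[cite: KosPolandSimmonsduffin2014ON, §2.1] -/
def wTp (N : ℕ) (w : Fin M → Fin 3 → ℝ) : Fin M → ℝ := fun k => -(1 + 2 / (N : ℝ)) * w k 2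
/-- `F⁻`-weights of the antisymmetric row: `-w_{k,0} + w_{k,1}`. [cite: KosPolandSimmonsduffin2014ON, §2.1] -/
def wAm (w : Fin M → Fin 3 → ℝ) : Fin M → ℝ := fun k => -w k 0 + w k 1
/-- `F⁺`-weights of the antisymmetric row: `-w_{k,2}`. [cite: KosPolandSimmonsduffin2014ON, §2.1] -/
def wAp (w : Fin M → Fin 3 → ℝ) : Fin M → ℝ := fun k => -w k 2

variable (w : Fin M → Fin 3 → ℝ) {z zb : Fin M → ℝ}

/-- Unfolding of the diamond functional. [cite: HogervorstRychkov2013, §4.3] -/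
theorem diamondFunctional_apply (z zb : Fin M → ℝ) (F : ℝ → ℝ → Fin 3 → ℝ) :
    diamondFunctional w z zb F = ∑ k, ∑ r, w k r * F (z k * zb k) ((1 - z k) * (1 - zb k)) r :=
  rfl

/-- **Singlet row = `φ[wSm](F⁻ g) + φ[wSp](F⁺ g)`** for a channel function pulling back to `g`.
[cite: KosPolandSimmonsduffin2014ON, §2.1] -/
theorem diamondFunctional_VS_eq (hz : ∀ k, z k ∈ Ioo (0 : ℝ) 1) (hzb : ∀ k, zb k ∈ Ioo (0 : ℝ) 1)
    {G g : ℝ → ℝ → ℝ} (hG : PullbackOnDiamond G g) (s : ℝ) :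
    diamondFunctional w z zb (fun u v => VS s G u v) =
      ConformalBootstrap3D.pointFunctional (wSm w) z zb (crossF s (-1) g) +
        ConformalBootstrap3D.pointFunctional (wSp w) z zb (crossF s 1 g) := by
  rw [diamondFunctional_apply, ConformalBootstrap3D.pointFunctional_apply,
    ConformalBootstrap3D.pointFunctional_apply, ← Finset.sum_add_distrib]
  refine Finset.sum_congr rfl fun k _ => ?_
  simp only [Fin.sum_univ_three, VS, Matrix.cons_val_zero, Matrix.cons_val_one, Matrix.head_cons,
    Matrix.cons_val_two, Matrix.tail_cons, hG.fm_eq (hz k) (hzb k), hG.fp_eq (hz k) (hzb k), wSm, wSp]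
  ring

/-- **Symmetric-tensor row = `φ[wTm](F⁻ g) + φ[wTp](F⁺ g)`.**
[cite: KosPolandSimmonsduffin2014ON, §2.1] -/
theorem diamondFunctional_VT_eq (hz : ∀ k, z k ∈ Ioo (0 : ℝ) 1) (hzb : ∀ k, zb k ∈ Ioo (0 : ℝ) 1)
    {G g : ℝ → ℝ → ℝ} (hG : PullbackOnDiamond G g) (N : ℕ) (s : ℝ) :
    diamondFunctional w z zb (fun u v => VT N s G u v) =
      ConformalBootstrap3D.pointFunctional (wTm N w) z zb (crossF s (-1) g) +
        ConformalBootstrap3D.pointFunctional (wTp N w) z zb (crossF s 1 g) := by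
  rw [diamondFunctional_apply, ConformalBootstrap3D.pointFunctional_apply,
    ConformalBootstrap3D.pointFunctional_apply, ← Finset.sum_add_distrib]
  refine Finset.sum_congr rfl fun k _ => ?_
  simp only [Fin.sum_univ_three, VT, Matrix.cons_val_zero, Matrix.cons_val_one, Matrix.head_cons,
    Matrix.cons_val_two, Matrix.tail_cons, hG.fm_eq (hz k) (hzb k), hG.fp_eq (hz k) (hzb k), wTm, wTp]
  ring

/-- **Antisymmetric row = `φ[wAm](F⁻ g) + φ[wAp](F⁺ g)`.** [cite: KosPolandSimmonsduffin2014ON, §2.1] -/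
theorem diamondFunctional_VA_eq (hz : ∀ k, z k ∈ Ioo (0 : ℝ) 1) (hzb : ∀ k, zb k ∈ Ioo (0 : ℝ) 1)
    {G g : ℝ → ℝ → ℝ} (hG : PullbackOnDiamond G g) (s : ℝ) :
    diamondFunctional w z zb (fun u v => VA s G u v) =
      ConformalBootstrap3D.pointFunctional (wAm w) z zb (crossF s (-1) g) +
        ConformalBootstrap3D.pointFunctional (wAp w) z zb (crossF s 1 g) := by
  rw [diamondFunctional_apply, ConformalBootstrap3D.pointFunctional_apply,
    ConformalBootstrap3D.pointFunctional_apply, ← Finset.sum_add_distrib]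
  refine Finset.sum_congr rfl fun k _ => ?_
  simp only [Fin.sum_univ_three, VA, Matrix.cons_val_zero, Matrix.cons_val_one, Matrix.head_cons,
    Matrix.cons_val_two, Matrix.tail_cons, hG.fm_eq (hz k) (hzb k), hG.fp_eq (hz k) (hzb k), wAm, wAp]
  ring

/-- **(O1) in single-correlator terms**: `α(V_S[1]) = φ[wSm](F⁻ 1) + φ[wSp](F⁺ 1)`.
[cite: KosPolandSimmonsduffin2014ON, §2.2] -/
theorem diamondFunctional_unit_eq (hz : ∀ k, z k ∈ Ioo (0 : ℝ) 1) (hzb : ∀ k, zb k ∈ Ioo (0 : ℝ) 1)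
    (s : ℝ) :
    diamondFunctional w z zb (fun u v => VS s (fun _ _ => (1 : ℝ)) u v) =
      ConformalBootstrap3D.pointFunctional (wSm w) z zb (crossF s (-1) fun _ _ => (1 : ℝ)) +
        ConformalBootstrap3D.pointFunctional (wSp w) z zb (crossF s 1 fun _ _ => (1 : ℝ)) :=
  diamondFunctional_VS_eq w hz hzb PullbackOnDiamond.one s

/-- **Singlet rows reduce to a two-functional sign condition on typed blocks**: if
`φ[wSm](crossF s (-1) g) + φ[wSp](crossF s 1 g) ≥ 0` for every `g` with
`IsConformalBlock3D 0 0 Δ ℓ g`, then `RowNonnegS` holds for the diamond functional — the form a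
`⟨σσσσ⟩`-type checker verifies with its block enclosures at the nodes `(z_k, z̄_k)` and
`(1-z_k, 1-z̄_k)`. [cite: KosPolandSimmonsduffin2014ON, §2.2] -/
theorem rowNonnegS_of_crossF (hz : ∀ k, z k ∈ Ioo (0 : ℝ) 1) (hzb : ∀ k, zb k ∈ Ioo (0 : ℝ) 1)
    {s Δ : ℝ} {ℓ : ℕ}
    (h : ∀ g : ℝ → ℝ → ℝ, IsConformalBlock3D 0 0 Δ ℓ g →
      0 ≤ ConformalBootstrap3D.pointFunctional (wSm w) z zb (crossF s (-1) g) +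
        ConformalBootstrap3D.pointFunctional (wSp w) z zb (crossF s 1 g)) :
    RowNonnegS (diamondFunctional w z zb) s Δ ℓ := by
  rintro G ⟨g, hg, hG⟩
  rw [diamondFunctional_VS_eq w hz hzb hG]
  exact h g hg

/-- Symmetric-tensor rows reduce likewise with weights `wTm N w`, `wTp N w`.
[cite: KosPolandSimmonsduffin2014ON, §2.2] -/
theorem rowNonnegT_of_crossF (hz : ∀ k, z k ∈ Ioo (0 : ℝ) 1) (hzb : ∀ k, zb k ∈ Ioo (0 : ℝ) 1)
    {N : ℕ} {s Δ : ℝ} {ℓ : ℕ}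
    (h : ∀ g : ℝ → ℝ → ℝ, IsConformalBlock3D 0 0 Δ ℓ g →
      0 ≤ ConformalBootstrap3D.pointFunctional (wTm N w) z zb (crossF s (-1) g) +
        ConformalBootstrap3D.pointFunctional (wTp N w) z zb (crossF s 1 g)) :
    RowNonnegT (diamondFunctional w z zb) N s Δ ℓ := by
  rintro G ⟨g, hg, hG⟩
  rw [diamondFunctional_VT_eq w hz hzb hG]
  exact h g hg

/-- Antisymmetric rows reduce likewise with weights `wAm w`, `wAp w`.
[cite: KosPolandSimmonsduffin2014ON, §2.2] -/
theorem rowNonnegA_of_crossF (hz : ∀ k, z k ∈ Ioo (0 : ℝ) 1) (hzb : ∀ k, zb k ∈ Ioo (0 : ℝ) 1)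
    {s Δ : ℝ} {ℓ : ℕ}
    (h : ∀ g : ℝ → ℝ → ℝ, IsConformalBlock3D 0 0 Δ ℓ g →
      0 ≤ ConformalBootstrap3D.pointFunctional (wAm w) z zb (crossF s (-1) g) +
        ConformalBootstrap3D.pointFunctional (wAp w) z zb (crossF s 1 g)) :
    RowNonnegA (diamondFunctional w z zb) s Δ ℓ := by
  rintro G ⟨g, hg, hG⟩
  rw [diamondFunctional_VA_eq w hz hzb hG]
  exact h g hg

/-- **The certificate theorem in dictionary form**: obligations stated for the diamond functional
prove `VectorExcluded N A Q` (`2 ≤ N`). [cite: KosPolandSimmonsduffin2014ON, §2.2] -/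
theorem vectorExcluded_of_diamondFunctional {N : ℕ} (hN : 2 ≤ N) {A : VectorGaps} {Q : Set ℝ}
    {E : ℝ} (hz : ∀ k, z k ∈ Ioo (0 : ℝ) 1) (hzb : ∀ k, zb k ∈ Ioo (0 : ℝ) 1)
    (h : VectorObligations (diamondFunctional w z zb) N A Q E) : VectorExcluded N A Q :=
  VectorObligations.excluded hN hz hzb h

end Dictionary

end

end Literature.MathematicalPhysics.QuantumFieldTheory.ONVectorCertificate
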